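import Mathlib.LinearAlgebra.Matrix.Rank
import Literature.NumberTheory.Transcendental.GammaFields
import Literature.NumberTheory.Transcendental.ZilberField
import Literature.NumberTheory.Transcendental.ExpVarieties
import Literature.NumberTheory.Transcendental.ZilberSaturation
import HarnessLib

/-!
# Bays–Kirby 2018, §11.1: generically (strongly) Γ-closed fields — exponential case

M. Bays, J. Kirby, *Pseudo-exponential maps, variants, and quasiminimality*, Algebra & Number
Theory 12 (2018) 493–549 (arXiv:1512.04262), §7 (Def. 7.1: strongly rotund varieties) and §11.1
(Def. 11.1: generic Γ-closedness GΓC and generic strong Γ-closedness GSΓC over `K`; Prop. 11.2: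
GSΓC over `K` ⟺ `ℵ₀`-saturation for Γ-algebraic extensions purely Γ-transcendental over `K`;
Prop. 11.5: GΓC over `K` ⟺ GSΓC over `K`, via the horizontal semiabelian weak Zilber–Pink
theorem 11.4), in the exponential case `k = ℚ`, `𝒪 = ℤ`, `d = 1`, `G = 𝔾ₐ × 𝔾ₘ`, `Γ` = graph of
`exp`, inside a fixed exponential field `F` (vocabulary of `ExpVarieties.lean` for subvarieties
of `Gⁿ = Fⁿ × (Fˣ)ⁿ` and of `GammaFields.lean` / `ZilberSaturation.lean` for Γ-subfields
`K + ℚc ≤ F`, predimension, `◁`, Γ-isomorphisms).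

## Purpose: decomposition of the saturation fact

`ZilberSaturation.lean` vendors, as ONE named fact
`Literature.NumberTheory.Transcendental.BaysKirby2018_saturation_of_isExpAlgClosed`, the conjunction "Γ-closed ⟹ GΓC (Cor. 11.7,
proof) ⟹ GSΓC (Prop. 11.5) ⟹ `ℵ₀`-saturated (Prop. 11.2)" on which the tree's proof of
Bays–Kirby Thm 1.5 / Cor. 11.7 rests (`ZilberQuasiminimalProofs.lean`). Here that fact is
**decomposed along the source's own numbering** into three named facts,

* `Literature.NumberTheory.Transcendental.BaysKirby2018_gammaPoints_dense_of_isExpAlgClosed` — Def. 10.3 with the remark following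
  it: exponential-algebraic closedness in the single-point form (`Literature.NumberTheory.Transcendental.IsExpAlgClosed`) gives the
  Zariski-dense form ("Rabinowitsch trick");
* `Literature.NumberTheory.Transcendental.BaysKirby2018_prop_11_5` — Prop. 11.5: GΓC over `K` ⟹ GSΓC over `K`;
* `Literature.NumberTheory.Transcendental.BaysKirby2018_prop_11_2` — Prop. 11.2 (⟹) with Def. 5.14: GSΓC over `K` ⟹ `F` is
  `ℵ₀`-saturated for Γ-algebraic extensions purely Γ-transcendental over `K` (instance inside
  `F`, exactly the body of the saturation fact),

and the saturation fact is PROVED from them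
(`Literature.NumberTheory.Transcendental.BaysKirby2018_saturation_of_isExpAlgClosed_of_facts`), the step "Γ-closed ⟹ GΓC over any
`K`" (Cor. 11.7, proof: "Clearly Γ-closedness implies generic Γ-closedness") being proved
(`GammaField.isGenericallyGammaClosedOver_of_dense`).

## Contents (definitions)

* `Literature.IsStronglyRotund F n V` — Def. 7.1 (`d = 1`): `dim [M]·V > rk M` for every non-zero
  `M ∈ Mₙ(ℤ)` (companion of `Literature.NumberTheory.Transcendental.IsRotund`, which is `dim [M]·V ≥ rk M` for all `M`).
* `Literature.GammaField.gammaPt a` — the point `α = (a, exp a) ∈ Γ(F)^r` of a tuple `a : Fin r → F`;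
  `Literature.GammaField.prodPt α β` — the point `(α, β) ∈ G^{r+n}` (blocks `(a, x ; exp a, y)`);
  `Literature.GammaField.LinIndepOver K a` — "`α` is `ℚ`-linearly independent over `Γ(K)`", i.e. `a` is
  `ℚ`-linearly independent modulo the subspace `K`;
  `Literature.GammaField.adjoinPt K a` — the subfield `K(α) = K₀(a, exp a)`, `K₀ = ℚ(K, exp K)`;
  `Literature.GammaField.kLocus K S` — the `K`-locus (smallest Zariski closed set defined over `K₀`
  containing `S`), used for `W := Loc(α, β/K)` = the `K`-locus of `{α} × V` (`locOver`), which is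
  how Def. 11.1's "for `β ∈ V` generic over `K(α)`, `W := Loc(α,β/K)`" is rendered without
  choosing `β` (`vanishingIdeal_prodPt_eq_of_isGenericOver` proves the two agree whenever such a
  generic `β` exists in `F`).
* `Literature.GammaField.IsGenericallyGammaClosedOver K` (GΓC over `K`) and
  `Literature.GammaField.IsGenericallyStronglyGammaClosedOver K` (GSΓC over `K`) — Def. 11.1.

## Faithfulness notes

* Varieties `V ⊆ Gⁿ` are presented, as in `Literature.NumberTheory.Transcendental.IsExpAlgClosed`, by their Zariski closure `W₀` in
  `F^{n ⊕ n}` (`V = W₀ ∩ torusLocus`): "irreducible of dimension `n`, free and rotund" is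
  `IsIrreducibleClosed F W₀ ∧ zariskiDim F W₀ = n ∧ IsAddFree ∧ IsMulFree ∧ IsRotund` of
  `W₀ ∩ torusLocus` (B–K Def. 7.1: free = `G₁`-free and `G₂`-free; rotund; `d = 1`).
* Def. 11.1 asks that `W = Loc(α, β/K)` be strongly rotund, calling `W` "the variety": `K` is a
  full Γ-field there (algebraically closed), so `W` is absolutely irreducible and Def. 7.1 applies
  in its irreducible form, which is what `IsStronglyRotund` states.
* The proof of Prop. 11.5 (p. 37, displays (11.2)–(11.3): "`α` was chosen … such that
  `⟨K, α⟩ ◁ F`, we have `Γdim^F(α/K) = δ(α/K)`") uses that the Γ-field generated by `α` over `K`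
  is strong in `F`, as it is in the situation Def. 11.1 abstracts (paragraph before Def. 11.1:
  `K ◁ A ◁ B`, `α` a basis of `A` over `K`) and in its application in Prop. 11.2. We therefore
  include `K + ℚa ◁ F` (`GammaField.IsStrong`) among the conditions on `α` in both GΓC and GSΓC;
  each definition thus quantifies over the pairs `(V, α)` actually treated in the source.
* GΓC's conclusion "`V(F) ∩ Γⁿ(F)` is Zariski-dense in `V`" is `I(W₀ ∩ expGraph) ≤ I(W₀)` over
  `F` (`expGraph ⊆ torusLocus`; `V` is dense in the irreducible `W₀`). GSΓC's conclusion is a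
  point `(g, exp g) ∈ V(F)` with `g` `ℚ`-linearly independent over `K + ℚa`
  ("`k_𝒪`-linearly independent over `Γ(K) ∪ α`").
* Def. 11.1 is stated for `F` full and `K ◁_cl F`, `K ≠ F`; the definitions below make sense
  for any `ℚ`-subspace `K`, and these standing hypotheses appear in the facts.

Nothing here is specific to `ℂ`.

## References

* M. Bays, J. Kirby, *Pseudo-exponential maps, variants, and quasiminimality*, Algebra & Number
  Theory 12 (2018) 493–549: Def. 3.19, Prop. 3.22, Def. 5.14, Def. 7.1, Prop. 7.3, Cor. 7.4,
  Lemma 8.3, Def. 10.3 (and the remark following it), Def. 11.1, Prop. 11.2, Fact 11.3, Thm 11.4,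
  Prop. 11.5, Cor. 11.7 (proof).
-/

noncomputable section

open Set MvPolynomial

universe u

namespace Literature.NumberTheory.Transcendental

section StronglyRotund

variable (F : Type*) [Field F] (n : ℕ)

/-- **Strongly rotund** subvarieties of `Gⁿ = Fⁿ × (Fˣ)ⁿ` (Bays–Kirby 2018, Def. 7.1, with
`d = dim G₁ = 1`): `V` is strongly rotund if `dim ([M]·V) > rk M` for every *non-zero* integer
matrix `M ∈ Mₙ(ℤ)`, where `[M]` acts additively on the first block and multiplicatively on the
second (`Literature.NumberTheory.Transcendental.matrixAct`) and `dim` is the Zariski dimension of the (constructible) image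
(`Literature.NumberTheory.Transcendental.zariskiDim`). Companion of `Literature.NumberTheory.Transcendental.IsRotund` (`dim ([M]·V) ≥ rk M` for all `M`). Stated, as in
Def. 7.1, for irreducible `V` (for reducible `V` the source asks it of some irreducible
component). [cite: BaysKirby2018ANT, Def. 7.1] -/
def IsStronglyRotund (V : Set (Fin n ⊕ Fin n → F)) : Prop :=
  ∀ M : Matrix (Fin n) (Fin n) ℤ, M ≠ 0 →
    ((M.map (Int.cast : ℤ → ℚ)).rank : WithBot ℕ∞) < zariskiDim F (matrixAct M '' V)

variable {F n}

/-- Strongly rotund and `dim ([0]·V) ≥ 0` give rotund: a strongly rotund nonempty `V` is rotund.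
[cite: BaysKirby2018ANT, Def. 7.1] -/
theorem IsStronglyRotund.isRotund {V : Set (Fin n ⊕ Fin n → F)} (h : IsStronglyRotund F n V)
    (hV : V.Nonempty) : IsRotund F n V := by
  intro M
  by_cases hM : M = 0
  · subst hM
    have h0 : ((0 : Matrix (Fin n) (Fin n) ℤ).map (Int.cast : ℤ → ℚ)).rank = 0 := by
      rw [Matrix.map_zero (Int.cast : ℤ → ℚ) Int.cast_zero]; exact Matrix.rank_zero
    rw [h0]
    -- the image is nonempty, so its dimension is `≥ 0`
    obtain ⟨z, hz⟩ := hV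
    have hne : (matrixAct (0 : Matrix (Fin n) (Fin n) ℤ) '' V).Nonempty := ⟨_, z, hz, rfl⟩
    obtain ⟨w, hw⟩ := hne
    have h1 : zariskiDim F ({w} : Set (Fin n ⊕ Fin n → F)) ≤ zariskiDim F (matrixAct 0 '' V) :=
      zariskiDim_mono (singleton_subset_iff.2 hw)
    refine le_trans ?_ h1
    -- a point has dimension `≥ 0`: its coordinate ring is nontrivial
    unfold zariskiDim
    have hnt : Nontrivial (MvPolynomial (Fin n ⊕ Fin n) F ⧸
        MvPolynomial.vanishingIdeal F ({w} : Set (Fin n ⊕ Fin n → F))) := by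
      refine Ideal.Quotient.nontrivial_iff.2 ?_
      intro htop
      have : (1 : MvPolynomial (Fin n ⊕ Fin n) F) ∈
          MvPolynomial.vanishingIdeal F ({w} : Set (Fin n ⊕ Fin n → F)) := by rw [htop]; trivial
      rw [MvPolynomial.mem_vanishingIdeal_iff] at this
      simpa using this w rfl
    have := ringKrullDim_nonneg_of_nontrivial (R := MvPolynomial (Fin n ⊕ Fin n) F ⧸
        MvPolynomial.vanishingIdeal F ({w} : Set (Fin n ⊕ Fin n → F)))
    exact_mod_cast this
  · exact (h M hM).le

end StronglyRotund

namespace GammaField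

open Literature.ModelTheory.ExponentialFields.ExponentialRing

section Points

variable {R : Type*}

/-- The point `(α, β) ∈ G^{r+n}` with blocks `(α₁, β₁ ; α₂, β₂)`: additive coordinates
`Fin.append (α ∘ inl) (β ∘ inl)`, multiplicative coordinates `Fin.append (α ∘ inr) (β ∘ inr)`
(`G^{r+n} = G^r × G^n` with `G = G₁ × G₂`). [cite: BaysKirby2018ANT, §11.1 (the tuple `ζ = (α, ξ)`)] -/
def prodPt {r n : ℕ} (α : Fin r ⊕ Fin r → R) (β : Fin n ⊕ Fin n → R) :
    Fin (r + n) ⊕ Fin (r + n) → R :=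
  Sum.elim (Fin.append (α ∘ Sum.inl) (β ∘ Sum.inl)) (Fin.append (α ∘ Sum.inr) (β ∘ Sum.inr))

/-- Additive coordinates of `(α, β)`. [folklore] -/
@[simp] theorem prodPt_inl {r n : ℕ} (α : Fin r ⊕ Fin r → R) (β : Fin n ⊕ Fin n → R)
    (i : Fin (r + n)) :
    prodPt α β (Sum.inl i) = Fin.append (α ∘ Sum.inl) (β ∘ Sum.inl) i :=
  rfl

/-- Multiplicative coordinates of `(α, β)`. [folklore] -/
@[simp] theorem prodPt_inr {r n : ℕ} (α : Fin r ⊕ Fin r → R) (β : Fin n ⊕ Fin n → R)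
    (i : Fin (r + n)) :
    prodPt α β (Sum.inr i) = Fin.append (α ∘ Sum.inr) (β ∘ Sum.inr) i :=
  rfl

/-- `prodPt α` is injective. [folklore] -/
theorem prodPt_injective {r n : ℕ} (α : Fin r ⊕ Fin r → R) :
    Function.Injective (prodPt (n := n) α) := by
  intro β β' h
  ext (i | i)
  · have := congrFun h (Sum.inl (Fin.natAdd r i))
    simpa [prodPt] using this
  · have := congrFun h (Sum.inr (Fin.natAdd r i))
    simpa [prodPt] using this

variable [Ring R] [Literature.ModelTheory.ExponentialFields.ExponentialRing R]

/-! ### Points of `Γ(F)^r` and of `G^{r+n}` -/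

/-- The point `α = (a, exp a) ∈ Γ(F)^r ⊆ G^r(F)` attached to a tuple `a : Fin r → F`
(additive block `a`, multiplicative block `exp a`). [cite: BaysKirby2018ANT, Def. 3.8] -/
def gammaPt {r : ℕ} (a : Fin r → R) : Fin r ⊕ Fin r → R :=
  Sum.elim a (fun i => exp (a i))

/-- Additive coordinates of `(a, exp a)`. [folklore] -/
@[simp] theorem gammaPt_inl {r : ℕ} (a : Fin r → R) (i : Fin r) : gammaPt a (Sum.inl i) = a i :=
  rfl

/-- Multiplicative coordinates of `(a, exp a)`. [folklore] -/
@[simp] theorem gammaPt_inr {r : ℕ} (a : Fin r → R) (i : Fin r) :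
    gammaPt a (Sum.inr i) = exp (a i) :=
  rfl

/-- `(a, exp a)` lies on the graph of exponentiation. [folklore] -/
theorem gammaPt_mem_expGraph {S : Type*} [Field S] [Literature.ModelTheory.ExponentialFields.ExponentialRing S] {r : ℕ} (a : Fin r → S) :
    gammaPt a ∈ expGraph S r :=
  fun _ => rfl

/-- A point of `G^r` lies on the graph of `exp` iff it is `(a, exp a)` for its additive part.
[folklore] -/
theorem mem_expGraph_iff_eq_gammaPt {S : Type*} [Field S] [Literature.ModelTheory.ExponentialFields.ExponentialRing S] {r : ℕ}
    (z : Fin r ⊕ Fin r → S) :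
    z ∈ expGraph S r ↔ z = gammaPt (z ∘ Sum.inl) := by
  constructor
  · intro hz
    ext (i | i)
    · rfl
    · exact hz i
  · intro hz i
    rw [hz]; rfl

/-- `(α, β)` is on the graph of `exp` iff both `α` and `β` are. [folklore] -/
theorem prodPt_mem_expGraph_iff {S : Type*} [Field S] [Literature.ModelTheory.ExponentialFields.ExponentialRing S] {r n : ℕ}
    (α : Fin r ⊕ Fin r → S) (β : Fin n ⊕ Fin n → S) :
    prodPt α β ∈ expGraph S (r + n) ↔ α ∈ expGraph S r ∧ β ∈ expGraph S n := by
  simp only [mem_expGraph_iff, prodPt_inr, prodPt_inl]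
  constructor
  · intro h
    refine ⟨fun i => ?_, fun i => ?_⟩
    · simpa using h (Fin.castAdd n i)
    · simpa using h (Fin.natAdd r i)
  · rintro ⟨hα, hβ⟩ i
    refine Fin.addCases (fun i => ?_) (fun i => ?_) i
    · simpa using hα i
    · simpa using hβ i

end Points

section LinIndep

variable {F : Type*} [Field F] [CharZero F]

/-! ### Linear independence over `Γ(K)` -/

/-- **`α = (a, exp a)` is `ℚ`-linearly independent over `Γ(K)`**: no non-trivial `ℚ`-linear
combination of the `aᵢ` lies in `K` (`k_𝒪 = ℚ`; `Γ(K)` is the graph of `exp` on the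
`ℚ`-subspace `K`). [cite: BaysKirby2018ANT, Def. 11.1] -/
def LinIndepOver (K : Submodule ℚ F) {r : ℕ} (a : Fin r → F) : Prop :=
  ∀ q : Fin r → ℚ, ∑ i, q i • a i ∈ K → q = 0

/-- `LinIndepOver K a` iff the images of the `aᵢ` in `F ⧸ K` are linearly independent.
[folklore] -/
theorem linIndepOver_iff (K : Submodule ℚ F) {r : ℕ} (a : Fin r → F) :
    LinIndepOver K a ↔ LinearIndependent ℚ (K.mkQ ∘ a) := by
  rw [Fintype.linearIndependent_iff]
  refine forall_congr' fun q => ?_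
  have : (∑ i, q i • (K.mkQ ∘ a) i) = K.mkQ (∑ i, q i • a i) := by
    simp [map_sum, map_smul]
  rw [this, Submodule.mkQ_apply, Submodule.Quotient.mk_eq_zero]
  constructor
  · intro h hq i; exact congrFun (h hq) i
  · intro h hq; exact funext (h hq)

/-- The empty tuple is linearly independent over any `K`. [folklore] -/
theorem linIndepOver_zero (K : Submodule ℚ F) (a : Fin 0 → F) : LinIndepOver K a :=
  fun _ _ => funext fun i => i.elim0

end LinIndep

variable {F : Type*} [Field F] [CharZero F] [Literature.ModelTheory.ExponentialFields.ExponentialRing F]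

/-! ### The field `K(α)` -/

/-- **The field `K(α)`** for `α = (a, exp a)`: the subfield of `F` generated over the Γ-subfield
`K₀ = ℚ(K, exp K)` (`GammaField.fieldOf K`) by the coordinates `aᵢ, exp aᵢ` of `α`.
[cite: BaysKirby2018ANT, Def. 11.1 ("`V` is defined over `K(α)`")] -/
def adjoinPt (K : Submodule ℚ F) {r : ℕ} (a : Fin r → F) : Subfield F :=
  Subfield.closure ((fieldOf K : Set F) ∪ range (gammaPt a))

/-- `K₀ ⊆ K(α)`. [folklore] -/
theorem fieldOf_le_adjoinPt (K : Submodule ℚ F) {r : ℕ} (a : Fin r → F) :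
    ((fieldOf K : Set F)) ⊆ adjoinPt K a :=
  fun _ hx => Subfield.subset_closure (Or.inl hx)

/-- The coordinates of `α` lie in `K(α)`. [folklore] -/
theorem gammaPt_mem_adjoinPt (K : Submodule ℚ F) {r : ℕ} (a : Fin r → F) (j : Fin r ⊕ Fin r) :
    gammaPt a j ∈ adjoinPt K a :=
  Subfield.subset_closure (Or.inr ⟨j, rfl⟩)

/-- `K(α) ⊆ ⟨K a⟩`, the Γ-subfield of `K + ℚa`. [folklore] -/
theorem adjoinPt_le_fieldOf_sup (K : Submodule ℚ F) {r : ℕ} (a : Fin r → F) :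
    (adjoinPt K a : Set F) ⊆ fieldOf (K ⊔ Submodule.span ℚ (range a)) := by
  have hle : adjoinPt K a ≤ (fieldOf (K ⊔ Submodule.span ℚ (range a))).toSubfield := by
    refine Subfield.closure_le.2 ?_
    rintro x (hx | ⟨j, rfl⟩)
    · exact fieldOf_mono le_sup_left hx
    · cases j with
      | inl i =>
        exact mem_fieldOf_of_mem (Submodule.mem_sup_right (Submodule.subset_span ⟨i, rfl⟩))
      | inr i =>
        exact exp_mem_fieldOf (Submodule.mem_sup_right (Submodule.subset_span ⟨i, rfl⟩))
  intro x hx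
  exact hle hx

/-! ### `K`-loci -/

/-- **The `K`-locus of a set `S ⊆ F^ι`**: the smallest Zariski closed subset of `F^ι` defined over
the Γ-subfield `K₀ = ℚ(K, exp K)` and containing `S`, i.e. the zero set of the polynomials over
`K₀` vanishing on `S`. For `S = {z}` this is the locus `Loc(z/K)` of Bays–Kirby §3.3 ("the
smallest Zariski-closed subset of `G`, defined over `A` and containing `b`").
[cite: BaysKirby2018ANT, §3.3 (locus)] -/
def kLocus (K : Submodule ℚ F) {ι : Type*} (S : Set (ι → F)) : Set (ι → F) :=
  MvPolynomial.zeroLocus F (MvPolynomial.vanishingIdeal (fieldOf K).toSubfield S)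

/-- `S ⊆ Loc_K(S)`. [folklore] -/
theorem subset_kLocus (K : Submodule ℚ F) {ι : Type*} (S : Set (ι → F)) : S ⊆ kLocus K S :=
  MvPolynomial.zeroLocus_vanishingIdeal_le S

/-- `Loc_K(S)` is defined over `K₀` (hence Zariski closed). [folklore] -/
theorem isDefinedOver_kLocus (K : Submodule ℚ F) {ι : Type*} (S : Set (ι → F)) :
    IsDefinedOver (fieldOf K).toSubfield (kLocus K S) :=
  ⟨_, rfl⟩

/-- `Loc_K` is monotone. [folklore] -/
theorem kLocus_mono (K : Submodule ℚ F) {ι : Type*} {S T : Set (ι → F)} (h : S ⊆ T) :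
    kLocus K S ⊆ kLocus K T :=
  MvPolynomial.zeroLocus_anti_mono (MvPolynomial.vanishingIdeal_anti_mono h)

/-- **`W := Loc(α, β/K)` rendered without `β`**: the `K`-locus of `{α} × V ⊆ G^{r+n}`, i.e. the
smallest Zariski closed set defined over `K₀` containing all points `(α, v)`, `v ∈ V`. When `V`
is defined over `K(α)` and `β ∈ V` is generic over `K(α)`, this is `Loc((α, β)/K)`
(`vanishingIdeal_prodPt_eq_of_isGenericOver`). [cite: BaysKirby2018ANT, Def. 11.1 (`W := Loc(α,β/K)`)] -/
def locOver (K : Submodule ℚ F) {r n : ℕ} (α : Fin r ⊕ Fin r → F) (V : Set (Fin n ⊕ Fin n → F)) :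
    Set (Fin (r + n) ⊕ Fin (r + n) → F) :=
  kLocus K (prodPt α '' V)

/-- `{α} × V ⊆ Loc(α, V/K)`. [folklore] -/
theorem prodPt_mem_locOver (K : Submodule ℚ F) {r n : ℕ} (α : Fin r ⊕ Fin r → F)
    {V : Set (Fin n ⊕ Fin n → F)} {v : Fin n ⊕ Fin n → F} (hv : v ∈ V) :
    prodPt α v ∈ locOver K α V :=
  subset_kLocus K _ ⟨v, hv, rfl⟩

/-! ### Def. 11.1: generic (strong) Γ-closedness over `K` -/

/-- **Generic Γ-closedness over `K`** (Bays–Kirby 2018, Def. 11.1, GΓC over `K`; exponential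
case inside `F`). For every subvariety `V = W₀ ∩ Gⁿ` of `Gⁿ = Fⁿ × (Fˣ)ⁿ` (presented by its
Zariski closure `W₀ ⊆ F^{n ⊕ n}`) which is irreducible of dimension `n`, additively and
multiplicatively free and rotund, and for which there is `α = (a, exp a) ∈ Γ(F)^r`,
`ℚ`-linearly independent over `Γ(K)` (`LinIndepOver K a`), generating over `K` a Γ-subfield
strong in `F` (`K + ℚa ◁ F`, used on p. 37 of the proof of Prop. 11.5, see the module
docstring), such that `V` is defined over `K(α)` (`adjoinPt K a`) and `W := Loc(α, β/K)` (for
`β ∈ V` generic over `K(α)`; here `locOver K α V`) is strongly rotund — the set `V(F) ∩ Γⁿ(F)` of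
points `(x, exp x)` of `V` is Zariski dense in `V`: every polynomial over `F` vanishing on
`W₀ ∩ expGraph` vanishes on `W₀`. [cite: BaysKirby2018ANT, Def. 11.1] -/
def IsGenericallyGammaClosedOver (K : Submodule ℚ F) : Prop :=
  ∀ (n r : ℕ) (W₀ : Set (Fin n ⊕ Fin n → F)) (a : Fin r → F),
    IsIrreducibleClosed F W₀ → (W₀ ∩ torusLocus F n).Nonempty → zariskiDim F W₀ = n →
    IsAddFree F n (W₀ ∩ torusLocus F n) → IsMulFree F n (W₀ ∩ torusLocus F n) →
    IsRotund F n (W₀ ∩ torusLocus F n) →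
    LinIndepOver K a → IsStrong (K ⊔ Submodule.span ℚ (range a)) →
    IsDefinedOver (adjoinPt K a) W₀ →
    IsStronglyRotund F (r + n)
      (locOver K (gammaPt a) (W₀ ∩ torusLocus F n) ∩ torusLocus F (r + n)) →
    MvPolynomial.vanishingIdeal F (W₀ ∩ expGraph F n) ≤ MvPolynomial.vanishingIdeal F W₀

/-- **Generic strong Γ-closedness over `K`** (Bays–Kirby 2018, Def. 11.1, GSΓC over `K`;
exponential case inside `F`). Whenever `V = W₀ ∩ Gⁿ` and `α = (a, exp a)` are as in
`IsGenericallyGammaClosedOver`, there is a point `γ = (g, exp g) ∈ V(F) ∩ Γⁿ(F)` which is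
`ℚ`-linearly independent over `Γ(K) ∪ α`, i.e. `g` is `ℚ`-linearly independent modulo `K + ℚa`.
[cite: BaysKirby2018ANT, Def. 11.1] -/
def IsGenericallyStronglyGammaClosedOver (K : Submodule ℚ F) : Prop :=
  ∀ (n r : ℕ) (W₀ : Set (Fin n ⊕ Fin n → F)) (a : Fin r → F),
    IsIrreducibleClosed F W₀ → (W₀ ∩ torusLocus F n).Nonempty → zariskiDim F W₀ = n →
    IsAddFree F n (W₀ ∩ torusLocus F n) → IsMulFree F n (W₀ ∩ torusLocus F n) →
    IsRotund F n (W₀ ∩ torusLocus F n) →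
    LinIndepOver K a → IsStrong (K ⊔ Submodule.span ℚ (range a)) →
    IsDefinedOver (adjoinPt K a) W₀ →
    IsStronglyRotund F (r + n)
      (locOver K (gammaPt a) (W₀ ∩ torusLocus F n) ∩ torusLocus F (r + n)) →
    ∃ g : Fin n → F, gammaPt g ∈ W₀ ∧ LinIndepOver (K ⊔ Submodule.span ℚ (range a)) g

/-- **Γ-closed (Zariski-dense form) ⟹ GΓC over every `K`** (Bays–Kirby 2018, proof of
Cor. 11.7: "Clearly Γ-closedness implies generic Γ-closedness"): if for *every* irreducible,
free and rotund `V ⊆ Gⁿ` of dimension `n` the Γ-points are Zariski dense in `V` (Def. 10.3),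
then in particular for those `V` admitting an `α` as in Def. 11.1.
[cite: BaysKirby2018ANT, Cor. 11.7 (proof)] -/
theorem isGenericallyGammaClosedOver_of_dense (K : Submodule ℚ F)
    (h : ∀ (n : ℕ) (W₀ : Set (Fin n ⊕ Fin n → F)), IsIrreducibleClosed F W₀ →
      (W₀ ∩ torusLocus F n).Nonempty → zariskiDim F W₀ = n →
      IsAddFree F n (W₀ ∩ torusLocus F n) → IsMulFree F n (W₀ ∩ torusLocus F n) →
      IsRotund F n (W₀ ∩ torusLocus F n) →
      MvPolynomial.vanishingIdeal F (W₀ ∩ expGraph F n) ≤ MvPolynomial.vanishingIdeal F W₀) :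
    IsGenericallyGammaClosedOver K :=
  fun n _ W₀ _ hirr hne hdim hadd hmul hrot _ _ _ _ => h n W₀ hirr hne hdim hadd hmul hrot

/-- Zariski density of the Γ-points gives a Γ-point (for `V ≠ ∅`): the dense form of
Γ-closedness implies the single-point form `Literature.NumberTheory.Transcendental.IsExpAlgClosed`. [cite: BaysKirby2018ANT, Def. 10.3 (remark)] -/
theorem isExpAlgClosed_of_dense
    (h : ∀ (n : ℕ) (W₀ : Set (Fin n ⊕ Fin n → F)), IsIrreducibleClosed F W₀ →
      (W₀ ∩ torusLocus F n).Nonempty → zariskiDim F W₀ = n →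
      IsAddFree F n (W₀ ∩ torusLocus F n) → IsMulFree F n (W₀ ∩ torusLocus F n) →
      IsRotund F n (W₀ ∩ torusLocus F n) →
      MvPolynomial.vanishingIdeal F (W₀ ∩ expGraph F n) ≤ MvPolynomial.vanishingIdeal F W₀) :
    IsExpAlgClosed F := by
  intro n W₀ hirr hne hrot hadd hmul hdim
  by_contra hempty
  rw [not_nonempty_iff_eq_empty] at hempty
  have hle := h n W₀ hirr hne hdim hadd hmul hrot
  rw [hempty, MvPolynomial.vanishingIdeal_empty, top_le_iff] at hle
  -- `I(W₀) = ⊤` forces `W₀ = ∅`, contradicting `W₀ ∩ Gⁿ ≠ ∅`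
  obtain ⟨z, hz, -⟩ := hne
  have h1 : (1 : MvPolynomial (Fin n ⊕ Fin n) F) ∈ MvPolynomial.vanishingIdeal F W₀ := by
    rw [hle]; trivial
  rw [MvPolynomial.mem_vanishingIdeal_iff] at h1
  simpa using h1 z hz

/-! ### `Loc(α, β/K)` agrees with the `β`-free rendering -/

/-- If `β ∈ V` is generic in `V` over `K(α)` then the polynomials over `K₀` vanishing at
`(α, β)` are exactly those vanishing on `{α} × V`; hence `Loc((α, β)/K) = locOver K α V`. (So the
`β`-free `W` of `IsGenericallyGammaClosedOver` is Def. 11.1's `W := Loc(α, β/K)` whenever a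
generic `β` exists in `F`; in general `β` lives in an extension of `F` and `W`, being defined
over `K`, is still the `K`-locus of `{α} × V`.) [cite: BaysKirby2018ANT, Def. 11.1] -/
theorem vanishingIdeal_prodPt_eq_of_isGenericOver (K : Submodule ℚ F) {r n : ℕ}
    (a : Fin r → F) {V : Set (Fin n ⊕ Fin n → F)} {β : Fin n ⊕ Fin n → F}
    (hβ : IsGenericOver (adjoinPt K a) V β) :
    MvPolynomial.vanishingIdeal (fieldOf K).toSubfield
        ({prodPt (gammaPt a) β} : Set (Fin (r + n) ⊕ Fin (r + n) → F)) =
      MvPolynomial.vanishingIdeal (fieldOf K).toSubfield (prodPt (gammaPt a) '' V) := by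
  classical
  set K₀ : Subfield F := (fieldOf K).toSubfield with hK₀
  set L : Subfield F := adjoinPt K a with hL
  -- substitute the coordinates of `α` (elements of `L`) for the `α`-variables, keep the
  -- `β`-variables: a `K₀`-algebra map `K₀[X_{r+n}, Y_{r+n}] → L[X_n, Y_n]`
  have hKL : ∀ x : F, x ∈ K₀ → x ∈ L := fun x hx => fieldOf_le_adjoinPt K a hx
  let ι : K₀ →+* L := (Subfield.inclusion fun x hx => hKL x hx)
  let φv : Fin (r + n) ⊕ Fin (r + n) → MvPolynomial (Fin n ⊕ Fin n) L :=
    Sum.elim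
      (Fin.addCases (fun i => MvPolynomial.C ⟨a i, gammaPt_mem_adjoinPt K a (Sum.inl i)⟩)
        (fun i => MvPolynomial.X (Sum.inl i)))
      (Fin.addCases (fun i => MvPolynomial.C ⟨exp (a i), gammaPt_mem_adjoinPt K a (Sum.inr i)⟩)
        (fun i => MvPolynomial.X (Sum.inr i)))
  let φ : MvPolynomial (Fin (r + n) ⊕ Fin (r + n)) K₀ →+* MvPolynomial (Fin n ⊕ Fin n) L :=
    MvPolynomial.eval₂Hom (MvPolynomial.C.comp ι) φv
  -- evaluation compatibility: `g(α, v) = (φ g)(v)`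
  have hφ : ∀ (g : MvPolynomial (Fin (r + n) ⊕ Fin (r + n)) K₀) (v : Fin n ⊕ Fin n → F),
      MvPolynomial.aeval (prodPt (gammaPt a) v) g = MvPolynomial.aeval v (φ g) := by
    intro g v
    induction g using MvPolynomial.induction_on with
    | C k =>
      simp only [φ, MvPolynomial.coe_eval₂Hom, MvPolynomial.eval₂_C, RingHom.comp_apply,
        MvPolynomial.aeval_C]
      rfl
    | add p q hp hq => simp only [map_add, hp, hq]
    | mul_X p j hp =>
      simp only [map_mul, hp, MvPolynomial.aeval_X, φ, MvPolynomial.coe_eval₂Hom,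
        MvPolynomial.eval₂_X]
      congr 1
      rcases j with j | j
      · simp only [prodPt_inl, φv, Sum.elim_inl]
        refine Fin.addCases (fun i => ?_) (fun i => ?_) j
        · simp [Fin.append_left]; rfl
        · simp [Fin.append_right]
      · simp only [prodPt_inr, φv, Sum.elim_inr]
        refine Fin.addCases (fun i => ?_) (fun i => ?_) j
        · simp [Fin.append_left]; rfl
        · simp [Fin.append_right]
  obtain ⟨hβV, hgen⟩ := hβ
  ext g
  simp only [MvPolynomial.mem_vanishingIdeal_iff, mem_singleton_iff, forall_eq, mem_image,
    forall_exists_index, and_imp, forall_apply_eq_imp_iff₂]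
  rw [hφ]
  constructor
  · intro h v hv
    rw [hφ]
    have hmem : φ g ∈ MvPolynomial.vanishingIdeal L ({β} : Set (Fin n ⊕ Fin n → F)) := by
      rw [MvPolynomial.mem_vanishingIdeal_iff]
      rintro _ rfl; exact h
    rw [hgen, MvPolynomial.mem_vanishingIdeal_iff] at hmem
    exact hmem v hv
  · intro h
    have hmem : φ g ∈ MvPolynomial.vanishingIdeal L V := by
      rw [MvPolynomial.mem_vanishingIdeal_iff]
      intro v hv
      rw [← hφ]; exact h v hv
    rw [← hgen, MvPolynomial.mem_vanishingIdeal_iff] at hmem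
    exact hmem β rfl

end GammaField

/-! ### The three named facts -/

open GammaField Literature.ModelTheory.ExponentialFields.ExponentialRing in
/-- **Bays–Kirby 2018, Def. 10.3 and the remark following it** ("Using the classical Rabinovich
trick, one can easily show this axiom scheme is equivalent to the existence of a single point
`β ∈ V(F) ∩ Γ(F)ⁿ`, for every such `V`"), exponential case: in a full exponential field
(algebraically closed, `exp` onto `Fˣ`) which is exponentially-algebraically closed in the
single-point form `Literature.NumberTheory.Transcendental.IsExpAlgClosed`, the Γ-points `(x, exp x)` of every irreducible, free and
rotund subvariety `V ⊆ Gⁿ` of dimension `n` are Zariski dense in `V` (Γ-closedness, Def. 10.3).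
[cite: BaysKirby2018ANT, Def. 10.3 (and the remark following it)] -/
def BaysKirby2018_gammaPoints_dense_of_isExpAlgClosed : Prop :=
  ∀ {F : Type*} [Field F] [CharZero F] [Literature.ModelTheory.ExponentialFields.ExponentialRing F],
    IsAlgClosed F → IsSurjectiveOntoUnits F → IsExpAlgClosed F →
    ∀ (n : ℕ) (W₀ : Set (Fin n ⊕ Fin n → F)), IsIrreducibleClosed F W₀ →
      (W₀ ∩ torusLocus F n).Nonempty → zariskiDim F W₀ = n →
      IsAddFree F n (W₀ ∩ torusLocus F n) → IsMulFree F n (W₀ ∩ torusLocus F n) →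
      IsRotund F n (W₀ ∩ torusLocus F n) →
      MvPolynomial.vanishingIdeal F (W₀ ∩ expGraph F n) ≤ MvPolynomial.vanishingIdeal F W₀

open GammaField Literature.ModelTheory.ExponentialFields.ExponentialRing in
/-- **Bays–Kirby 2018, Prop. 11.5** (exponential case, direction GΓC ⟹ GSΓC; the converse is
"immediate"): for a full Γ-field `F` (algebraically closed, `exp` onto `Fˣ`) and `K ◁_cl F`,
`K ≠ F` (`GammaField.IsGammaClosed K`, `K ≠ ⊤`), if `F` is generically Γ-closed over `K` then it
is generically strongly Γ-closed over `K`. The printed proof covers `V_{α,dep}`, the points of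
`V(F)` linearly dependent over `Γ(K) ∪ α`, by a proper Zariski closed subset of `V`, using the
horizontal semiabelian weak Zilber–Pink theorem (Thm 11.4, from Fact 11.3 = Kirby 2009) and the
fibre dimension theorem. Deep; named fact (D-0014). [cite: BaysKirby2018ANT, Prop. 11.5] -/
def BaysKirby2018_prop_11_5 : Prop :=
  ∀ {F : Type*} [Field F] [CharZero F] [Literature.ModelTheory.ExponentialFields.ExponentialRing F],
    IsAlgClosed F → IsSurjectiveOntoUnits F →
    ∀ {K : Submodule ℚ F}, IsGammaClosed K → K ≠ ⊤ →
      IsGenericallyGammaClosedOver K → IsGenericallyStronglyGammaClosedOver K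

open GammaField Literature.ModelTheory.ExponentialFields.ExponentialRing in
/-- **Bays–Kirby 2018, Prop. 11.2 (⟹) with Def. 5.14** (exponential case, inside `F`): for a
full Γ-field `F` and a countable `K ◁_cl F`, `K ≠ F`, if `F` is generically strongly Γ-closed
over `K` then `F` is `ℵ₀`-saturated for Γ-algebraic extensions which are purely
Γ-transcendental over `K`: whenever `K ◁ A ◁ F` with `A` finitely generated over `K` and `A ◁ B`
is a finitely generated Γ-algebraic extension (purely Γ-transcendental over `K`), `B` embeds
(necessarily strongly) into `F` over `A`. ("This is essentially the same as the proof of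
Lemma 8.3": reduce to `A = A^full ∧ B`, take a good basis `b` of `B` over `A` (Prop. 3.22, Kummer
theory), so that `V = Loc(b/A)` is free and rotund of dimension `n` (Cor. 7.4) and determines
`B`; a point of `V(F) ∩ Γⁿ` independent over `Γ(K) ∪ α` is generic in `V` over `A` since
`A ◁ F`, hence generates a copy of `B`.)

Instance stated, as in `Literature.NumberTheory.Transcendental.BaysKirby2018_saturation_of_isExpAlgClosed`: `A = ⟨K c'⟩ ◁ F`;
`B = ⟨K c e⟩ ⊆ F` regarded as an extension of `A` through the Γ-isomorphism `c ↦ c'` over `K`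
(`GammaField.IsGammaIso`), with `⟨K c⟩ ◁ F` and `δ(e/⟨K c⟩) = 0` (so `⟨K c⟩ ◁ B` is
Γ-algebraic, Def. 5.11, and `B` is purely Γ-transcendental over `K` because `K ◁_cl F`,
Def. 5.16); conclusion: a tuple `e'` with `(c, e) ↦ (c', e')` a Γ-isomorphism over `K` and
`⟨K c' e'⟩ ◁ F`. Named fact (D-0014). [cite: BaysKirby2018ANT, Prop. 11.2, Def. 5.14, Lemma 8.3 (proof), Prop. 3.22, Cor. 7.4] -/
def BaysKirby2018_prop_11_2 : Prop :=
  ∀ {F : Type*} [Field F] [CharZero F] [Literature.ModelTheory.ExponentialFields.ExponentialRing F],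
    IsAlgClosed F → IsSurjectiveOntoUnits F →
    ∀ {K : Submodule ℚ F}, GammaField.IsGammaClosed K → K ≠ ⊤ → (K : Set F).Countable →
      GammaField.IsGenericallyStronglyGammaClosedOver K →
      ∀ {N k : ℕ} {c c' : Fin N → F} {e : Fin k → F},
        GammaField.IsStrong (K ⊔ Submodule.span ℚ (range c)) →
        GammaField.IsStrong (K ⊔ Submodule.span ℚ (range c')) →
        GammaField.IsGammaIso K c c' →
        GammaField.predim (K ⊔ Submodule.span ℚ (range c)) (Submodule.span ℚ (range e)) = 0 →
        ∃ e' : Fin k → F, GammaField.IsGammaIso K (Fin.append c e) (Fin.append c' e') ∧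
          GammaField.IsStrong (K ⊔ Submodule.span ℚ (range (Fin.append c' e')))

/-! ### Assembly: the saturation fact from the three source-numbered facts -/

open GammaField Literature.ModelTheory.ExponentialFields.ExponentialRing in
/-- **Γ-closed ⟹ GSΓC over `K`** (Bays–Kirby 2018, proof of Cor. 11.7 with Prop. 11.5): in a
full, exponentially-algebraically closed `F`, for every `K ◁_cl F`, `K ≠ F`, the field `F` is
generically strongly Γ-closed over `K` — from the density fact (Def. 10.3, remark) and
Prop. 11.5. [cite: BaysKirby2018ANT, Cor. 11.7 (proof), Prop. 11.5] -/
theorem isGenericallyStronglyGammaClosedOver_of_isExpAlgClosed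
    (hR : BaysKirby2018_gammaPoints_dense_of_isExpAlgClosed.{u}) (h5 : BaysKirby2018_prop_11_5.{u})
    {F : Type u} [Field F] [CharZero F] [Literature.ModelTheory.ExponentialFields.ExponentialRing F]
    (hF : IsAlgClosed F) (hsurj : IsSurjectiveOntoUnits F) (hEAC : IsExpAlgClosed F)
    {K : Submodule ℚ F} (hKΓ : IsGammaClosed K) (hKtop : K ≠ ⊤) :
    IsGenericallyStronglyGammaClosedOver K :=
  h5 hF hsurj hKΓ hKtop (isGenericallyGammaClosedOver_of_dense K (hR hF hsurj hEAC))

open GammaField Literature.ModelTheory.ExponentialFields.ExponentialRing in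
/-- **The saturation fact from its source-numbered parts.**
`Literature.NumberTheory.Transcendental.BaysKirby2018_saturation_of_isExpAlgClosed` (`ZilberSaturation.lean`) follows from
Def. 10.3 (remark) + Prop. 11.5 + Prop. 11.2: Γ-closed ⟹ GΓC over `K` (Cor. 11.7, proof) ⟹ GSΓC
over `K` ⟹ `ℵ₀`-saturation. [cite: BaysKirby2018ANT, Cor. 11.7 (proof), Prop. 11.5, Prop. 11.2] -/
theorem BaysKirby2018_saturation_of_isExpAlgClosed_of_facts
    (hR : BaysKirby2018_gammaPoints_dense_of_isExpAlgClosed.{u})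
    (h5 : BaysKirby2018_prop_11_5.{u}) (h2 : BaysKirby2018_prop_11_2.{u}) :
    BaysKirby2018_saturation_of_isExpAlgClosed.{u} :=
  fun hF hsurj hEAC _ hKΓ hKtop hKc _ _ _ _ _ hs hs' hiso hδ _ =>
    h2 hF hsurj hKΓ hKtop hKc
      (isGenericallyStronglyGammaClosedOver_of_isExpAlgClosed hR h5 hF hsurj hEAC hKΓ hKtop)
      hs hs' hiso hδ

end Literature.NumberTheory.Transcendental
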